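import Literature.NumberTheory.Sieve.LinearEquationsInPrimesInverseU2
import Literature.Analysis.Fourier.LipschitzFourierTail
import HarnessLib

/-!
# Nilsequences on the circle: Cor. 11.6 and Prop. 10.2 of Green–Tao 2010 at `s = 1`

Trunk T-SIEVE (`Literature/NumberTheory/Sieve`). Part of the decomposition of
`Literature.NumberTheory.Sieve.GreenTao2010_gowersUniformity` (B. Green, T. Tao, *Linear equations
in primes*, Ann. of Math. 171 (2010), Thm. 7.2). After `LinearEquationsInPrimesInverseU2.lean`
(`GI(1)` proved with the family `{ℝ/ℤ}`), Thm. 7.2 at level `s = 1` rests on Cor. 11.6 and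
Prop. 10.2 for `2π`-Lipschitz `1`-bounded functions on the circle
(`GreenTao2010_gowersUniformityAt_one_of_circle`). Here:

* `Literature.NumberTheory.Sieve.uniformityNorm_ge_of_expSum` — **a large exponential sum forces
  a large `U²[N]` norm**, for `L¹`-bounded weights: `∑_{n≤N}|f| ≤ N`,
  `|∑_{n≤N} f(n)e(nβ)| ≥ ηN` ⇒ `‖f‖_{U²[N]} ≥ η/(2T)`, `T = ⌈2π/η⌉ + 2` (embed `[N] ↪ ℤ_{NT}`, round
  `β` to `ξ/NT`, Lemma B.5 and `‖·‖_{U²}^4 = ∑|f̂|⁴` from `LinearEquationsInPrimesFourierU2.lean`);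
* `Literature.NumberTheory.Sieve.abs_orbitAverage_circle_le` — correlations with a rotation
  nilsequence `F(x₀ + nα)` decompose into exponential sums:
  `|𝔼 a(n)F(x₀+nα)| ≤ (M/√K) 𝔼|a| + (1/N)∑_{|m|<K} |∑ a(n) e(nmα)|` (Bernstein's theorem,
  `Literature.Analysis.Fourier.norm_sub_trigPoly_le`);
* `Literature.NumberTheory.Sieve.GreenTao2010_nilObstructionAt_one_circle` — **Cor. 11.6 for the
  circle, PROVED**: `GreenTao2010_nilObstructionAt 1 circle M` for every `M`;
* `Literature.NumberTheory.Sieve.GreenTao2010_nilsequenceOrthogonalityAt_one_circle_of_expSum` —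
  **Prop. 10.2 for the circle from the uniform exponential-sum estimate**
  `sup_α |∑_{n≤N} (Λ'_{b,W}(n) - 1) e(nα)| = o(N)` (uniform in `b`, `w`): the `s = 1` content of
  "`MN(1)` (Davenport) + §12 ⇒ Prop. 10.2", reduced to its classical circle-method core;
* `Literature.NumberTheory.Sieve.GreenTao2010_gowersUniformityAt_one_of_expSum` — consequently
  **Thm. 7.2 at level `s = 1` (the `U²[N]`-uniformity of `Λ'_{b,W} - 1`, controlling all systems
  of complexity `1`) follows from that single exponential-sum estimate**, every other ingredient
  (Prop. 6.4, Prop. 7.1, §§4–7, `GI(1)`, Cor. 11.6 on the circle, Prop. 10.1, Prop. 10.3) being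
  proved in the tree.

## References

* B. Green, T. Tao, *Linear equations in primes*, Ann. of Math. (2) 171 (2010), 1753–1850
  (arXiv:math/0606088): Cor. 11.6, §11 (first paragraph: the case `s = 1` "amounts to a certain
  `ℓ^{4/3}` summability estimate on the Fourier coefficients of Lipschitz functions"), Prop. 10.2,
  §12, Conj. 8.5. [cite: GreenTao2010, Cor. 11.6 and Prop. 10.2]
* Y. Katznelson, *An Introduction to Harmonic Analysis*, 3rd ed. (2004), Ch. I, §6.3 (Bernstein).
  [cite: Katznelson2004, Ch. I, §6.3]
-/

noncomputable section

open Finset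
open scoped BigOperators

namespace Literature.NumberTheory.Sieve

open Complex in
/-! ### Exponential sums and the `U²[N]` norm of `L¹`-bounded functions -/

section expsum


/-- A sum over `[1, N] ⊆ ℤ` is the corresponding sum over `[1, N] ⊆ ℕ`. [folklore] -/
theorem sum_Icc_int_eq_sum_Icc_nat (g : ℤ → ℝ) (N : ℕ) :
    ∑ n ∈ Finset.Icc (1 : ℤ) N, g n = ∑ n ∈ Finset.Icc 1 N, g (n : ℕ) := by
  classical
  have himage : (Finset.Icc 1 N).image (fun n : ℕ => (n : ℤ)) = Finset.Icc (1 : ℤ) N := by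
    ext m
    simp only [Finset.mem_image, Finset.mem_Icc]
    constructor
    · rintro ⟨n, ⟨h1, h2⟩, rfl⟩; exact ⟨by exact_mod_cast h1, by exact_mod_cast h2⟩
    · rintro ⟨h1, h2⟩
      refine ⟨m.toNat, ⟨by omega, by omega⟩, by omega⟩
  rw [← himage, Finset.sum_image fun a _ b _ h => by exact_mod_cast h]

/-- `e(t) = exp(2πit)`. [folklore] -/
def eChar (t : ℝ) : ℂ := Complex.exp (((2 * Real.pi * t : ℝ) : ℂ) * Complex.I)

/-- `|e(t)| = 1`. [folklore] -/
theorem norm_eChar (t : ℝ) : ‖eChar t‖ = 1 := by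
  unfold eChar; exact Complex.norm_exp_ofReal_mul_I _

/-- `e(a + b) = e(a) e(b)`. [folklore] -/
theorem eChar_add (a b : ℝ) : eChar (a + b) = eChar a * eChar b := by
  unfold eChar
  rw [← Complex.exp_add]
  congr 1
  push_cast
  ring

/-- `e(-t) = conj e(t)`. [folklore] -/
theorem eChar_neg (t : ℝ) : eChar (-t) = (starRingEnd ℂ) (eChar t) := by
  unfold eChar
  rw [← Complex.exp_conj]
  congr 1
  simp only [map_mul, Complex.conj_ofReal, Complex.conj_I]
  push_cast
  ring

/-- `|e(a) - e(b)| ≤ 2π |a - b|`. [folklore] -/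
theorem norm_eChar_sub_eChar_le (a b : ℝ) : ‖eChar a - eChar b‖ ≤ 2 * Real.pi * |a - b| := by
  have key : ∀ θ : ℝ, ‖Complex.exp (θ * Complex.I) - 1‖ ≤ |θ| := by
    intro θ
    have h1 : ‖Complex.exp (θ * Complex.I) - 1‖ ^ 2 = 2 - 2 * Real.cos θ := by
      rw [Complex.sq_norm, Complex.normSq_apply]
      simp only [Complex.sub_re, Complex.sub_im, Complex.exp_ofReal_mul_I_re,
        Complex.exp_ofReal_mul_I_im, Complex.one_re, Complex.one_im, sub_zero]
      nlinarith [Real.sin_sq_add_cos_sq θ]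
    have h2 : 2 - 2 * Real.cos θ ≤ θ ^ 2 := by nlinarith [Real.one_sub_sq_div_two_le_cos (x := θ)]
    have h3 : ‖Complex.exp (θ * Complex.I) - 1‖ ^ 2 ≤ |θ| ^ 2 := by rw [sq_abs]; linarith
    exact (pow_le_pow_iff_left₀ (norm_nonneg _) (abs_nonneg _) two_ne_zero).mp h3
  have hsplit : eChar a - eChar b = eChar b * (eChar (a - b) - 1) := by
    rw [mul_sub, mul_one, ← eChar_add, add_sub_cancel]
  rw [hsplit, norm_mul, norm_eChar, one_mul]
  unfold eChar
  refine (key _).trans (le_of_eq ?_)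
  rw [abs_mul, abs_of_pos Real.two_pi_pos]

/-- Exponential sums with `e(-nt)` and `e(nt)` against a real sequence have the same size (they are
complex conjugates). [folklore] -/
theorem norm_sum_mul_eChar_neg {ι : Type*} (s : Finset ι) (a : ι → ℝ) (t : ι → ℝ) :
    ‖∑ i ∈ s, (a i : ℂ) * eChar (-t i)‖ = ‖∑ i ∈ s, (a i : ℂ) * eChar (t i)‖ := by
  have : ∑ i ∈ s, (a i : ℂ) * eChar (-t i) = (starRingEnd ℂ) (∑ i ∈ s, (a i : ℂ) * eChar (t i)) := by
    rw [map_sum]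
    refine Finset.sum_congr rfl fun i _ => ?_
    rw [map_mul, Complex.conj_ofReal, eChar_neg]
  rw [this, Complex.norm_conj]

/-- The standard additive character of `ℤ_{N'}` in terms of `e(·)`. [folklore] -/
theorem stdAddChar_intCast_eq_eChar {N' : ℕ} [NeZero N'] (j : ℤ) :
    (ZMod.stdAddChar (j : ZMod N') : ℂ) = eChar (j / N') := by
  rw [ZMod.stdAddChar_coe]
  unfold eChar
  congr 1
  push_cast
  ring

/-- The modulus `T = ⌈2π/η⌉ + 2` of the embedding `[N] ↪ ℤ_{NT}` used to discretise a real
frequency at precision `η`. [folklore] -/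
def expSumMod (η : ℝ) : ℕ := ⌈2 * Real.pi / η⌉₊ + 2

/-- `expSumMod η ≥ 2`. [folklore] -/
theorem two_le_expSumMod (η : ℝ) : 2 ≤ expSumMod η := by unfold expSumMod; omega

/-- `π / expSumMod η ≤ η / 2` for `η > 0`. [folklore] -/
theorem pi_div_expSumMod_le {η : ℝ} (hη : 0 < η) : Real.pi / expSumMod η ≤ η / 2 := by
  have h1 : 2 * Real.pi / η ≤ expSumMod η := by
    unfold expSumMod
    push_cast
    linarith [Nat.le_ceil (2 * Real.pi / η)]
  have hT : (0 : ℝ) < expSumMod η := by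
    have := two_le_expSumMod η
    exact_mod_cast (show 0 < expSumMod η by omega)
  rw [div_le_iff₀ hT]
  rw [div_le_iff₀ hη] at h1
  nlinarith

/-- **An exponential sum bound from below forces a large `U²[N]` norm**, for `L¹`-bounded weights:
if `∑_{n ≤ N} |f(n)| ≤ N` and `|∑_{n ≤ N} f(n) e(nβ)| ≥ ηN` for some real `β`, then
`‖f‖_{U²[N]} ≥ η / (2T)`, `T = ⌈2π/η⌉ + 2`. (Embed `[N]` in `ℤ_{NT}`, replace `β` by the nearest
`ξ/NT` at cost `≤ πN/T ≤ ηN/2`, so that `|f̂(ξ)| ≥ η/2T` on `ℤ_{NT}`; then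
`‖f‖_{U²[N]}^4 ≥ ‖f 1_{[N]}‖_{U²(ℤ_{NT})}^4 = ∑ |f̂|⁴ ≥ |f̂(ξ)|⁴` by Lemma B.5 and the `U²` Fourier
identity.) [cite: GreenTao2010, §8 (Prop. 8.2 / Cor. 11.6 at `s = 1`: "exercise in harmonic
analysis") and App. B, Lemma B.5] -/
theorem uniformityNorm_ge_of_expSum {N : ℕ} (hN : 1 ≤ N) (f : ℤ → ℝ)
    (hf1 : ∑ n ∈ Finset.Icc 1 N, |f (n : ℕ)| ≤ N) {η : ℝ} (hη : 0 < η) (β : ℝ)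
    (hS : η * N ≤ ‖∑ n ∈ Finset.Icc 1 N, (f (n : ℕ) : ℂ) * eChar (n * β)‖) :
    η / (2 * expSumMod η) ≤ uniformityNorm 2 N (fun n => ((f n : ℝ) : ℂ)) := by
  set T : ℕ := expSumMod η with hT
  have hT2 : 2 ≤ T := two_le_expSumMod η
  have hTpos : (0 : ℝ) < T := by exact_mod_cast (show 0 < T by omega)
  have hNpos : (0 : ℝ) < N := by exact_mod_cast hN
  set N' : ℕ := N * T with hN'
  have hN'pos : 0 < N' := Nat.mul_pos (by omega) (by omega)
  haveI : NeZero N' := ⟨hN'pos.ne'⟩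
  have hNN' : N < N' := by rw [hN']; nlinarith
  have h2N : 2 * N ≤ N' := by rw [hN']; nlinarith
  have hN'r : (N' : ℝ) = N * T := by rw [hN']; push_cast; ring
  have hN'rpos : (0 : ℝ) < N' := by exact_mod_cast hN'pos
  -- the nearest discrete frequency
  set ξ : ℤ := round (β * N') with hξ
  have hβξ : |β - ξ / N'| ≤ 1 / (2 * N') := by
    have h := abs_sub_round (β * N')
    rw [← hξ] at h
    have : β - ξ / N' = (β * N' - ξ) / N' := by field_simp
    rw [this, abs_div, abs_of_pos hN'rpos, div_le_div_iff₀ hN'rpos (by positivity)]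
    nlinarith
  -- the discretised exponential sum is still large
  set S' : ℂ := ∑ n ∈ Finset.Icc 1 N, (f (n : ℕ) : ℂ) * eChar (n * (ξ / N')) with hS'
  have hdiff : ‖(∑ n ∈ Finset.Icc 1 N, (f (n : ℕ) : ℂ) * eChar (n * β)) - S'‖ ≤ Real.pi / T * N := by
    rw [hS', ← Finset.sum_sub_distrib]
    refine (norm_sum_le _ _).trans ?_
    have hterm : ∀ n ∈ Finset.Icc 1 N,
        ‖(f (n : ℕ) : ℂ) * eChar (n * β) - (f (n : ℕ) : ℂ) * eChar (n * (ξ / N'))‖ ≤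
          |f (n : ℕ)| * (Real.pi / T) := by
      intro n hn
      have hn' := (Finset.mem_Icc.mp hn).2
      rw [← mul_sub, norm_mul, Complex.norm_real, Real.norm_eq_abs]
      refine mul_le_mul_of_nonneg_left ?_ (abs_nonneg _)
      refine (norm_eChar_sub_eChar_le _ _).trans ?_
      rw [← mul_sub, abs_mul, Nat.abs_cast]
      have hnN : (n : ℝ) ≤ N := by exact_mod_cast hn'
      calc 2 * Real.pi * (n * |β - ξ / N'|) ≤ 2 * Real.pi * (N * (1 / (2 * N'))) := by
            gcongr
        _ = Real.pi / T := by rw [hN'r]; field_simp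
    refine (Finset.sum_le_sum hterm).trans ?_
    rw [← Finset.sum_mul]
    calc (∑ n ∈ Finset.Icc 1 N, |f (n : ℕ)|) * (Real.pi / T) ≤ N * (Real.pi / T) :=
          mul_le_mul_of_nonneg_right hf1 (by positivity)
      _ = Real.pi / T * N := mul_comm _ _
  have hS'ge : η / 2 * N ≤ ‖S'‖ := by
    have h1 : ‖∑ n ∈ Finset.Icc 1 N, (f (n : ℕ) : ℂ) * eChar (n * β)‖ ≤ ‖S'‖ + Real.pi / T * N := by
      calc ‖∑ n ∈ Finset.Icc 1 N, (f (n : ℕ) : ℂ) * eChar (n * β)‖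
          = ‖S' + ((∑ n ∈ Finset.Icc 1 N, (f (n : ℕ) : ℂ) * eChar (n * β)) - S')‖ := by
            rw [add_sub_cancel]
        _ ≤ ‖S'‖ + ‖(∑ n ∈ Finset.Icc 1 N, (f (n : ℕ) : ℂ) * eChar (n * β)) - S'‖ := norm_add_le _ _
        _ ≤ ‖S'‖ + Real.pi / T * N := add_le_add le_rfl hdiff
    have h2 : Real.pi / T ≤ η / 2 := pi_div_expSumMod_le hη
    nlinarith
  -- the Fourier coefficient of `f 1_{[N]}` at `ξ`
  set Ff : ZMod N' → ℝ := extendByZero N' N f with hFf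
  have hdft : ‖dftCoeff Ff (ξ : ZMod N')‖ = ‖S'‖ / N' := by
    unfold dftCoeff
    rw [norm_div, Complex.norm_natCast]
    congr 1
    rw [sum_extendByZero_mul hNN' f, hS', ← norm_sum_mul_eChar_neg]
    congr 1
    refine Finset.sum_congr rfl fun n _ => ?_
    congr 1
    have hcast : -(((n : ℕ) : ZMod N') * (ξ : ZMod N')) = (((-(n * ξ) : ℤ)) : ZMod N') := by
      push_cast; ring
    rw [hcast, stdAddChar_intCast_eq_eChar]
    congr 1
    push_cast
    ring
  have hcoef : η / (2 * T) ≤ ‖dftCoeff Ff (ξ : ZMod N')‖ := by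
    rw [hdft, hN'r, le_div_iff₀ (by positivity)]
    calc η / (2 * T) * (N * T) = η / 2 * N := by field_simp
      _ ≤ ‖S'‖ := hS'ge
  -- `U²` lower bound via Lemma B.5
  have hgp : (η / (2 * T)) ^ 4 ≤ gowersPower 2 Ff :=
    (pow_le_pow_left₀ (by positivity) hcoef 4).trans (norm_dftCoeff_pow_four_le Ff _)
  have hB5 := gowersPower_extendByZero_le (k := 2) hN h2N f
  have h4 : (η / (2 * T)) ^ 4 ≤ uniformityNorm 2 N (fun n => ((f n : ℝ) : ℂ)) ^ 4 := by
    have := hgp.trans hB5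
    simpa using this
  exact (pow_le_pow_iff_left₀ (by positivity) (uniformityNorm_nonneg _ _ _) (by norm_num)).mp h4

end expsum

/-! ### Cor. 11.6 for the circle: nilsequences on `ℝ/ℤ` obstruct `U²`-uniformity -/

section circleobs

open Literature.Analysis.Fourier in
/-- A `1`-bounded `M`-Lipschitz function on the circle nilmanifold, read on `AddCircle 1` with complex
values (the two quotients `ℝ/ℤ` coincide). [folklore] -/
def toCircleFun (F : Nilmanifold.circle.G ⧸ Nilmanifold.circle.Γ → ℝ) (y : AddCircle (1 : ℝ)) : ℂ :=
  ((F (show Nilmanifold.circle.G ⧸ Nilmanifold.circle.Γ from y) : ℝ) : ℂ)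

/-- `toCircleFun F (r + ℤ) = F(r + ℤ)`. [folklore] -/
theorem toCircleFun_coe (F : Nilmanifold.circle.G ⧸ Nilmanifold.circle.Γ → ℝ) (r : ℝ) :
    toCircleFun F ((r : ℝ) : AddCircle (1 : ℝ)) = ((F (circlePt r) : ℝ) : ℂ) := rfl

/-- The Lipschitz and boundedness properties transfer to `AddCircle 1`. [folklore] -/
theorem toCircleFun_lipschitz {M : ℝ} {F : Nilmanifold.circle.G ⧸ Nilmanifold.circle.Γ → ℝ}
    (hF : Nilmanifold.circle.IsBoundedLipschitz M F) (y z : AddCircle (1 : ℝ)) :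
    ‖toCircleFun F y - toCircleFun F z‖ ≤ max M 0 * dist y z := by
  unfold toCircleFun
  rw [← Complex.ofReal_sub, Complex.norm_real, Real.norm_eq_abs]
  refine (hF.2 _ _).trans ?_
  rw [Nilmanifold.circle_dist_eq]
  exact mul_le_mul_of_nonneg_right (le_max_left _ _) dist_nonneg

/-- Boundedness transfers. [folklore] -/
theorem norm_toCircleFun_le {M : ℝ} {F : Nilmanifold.circle.G ⧸ Nilmanifold.circle.Γ → ℝ}
    (hF : Nilmanifold.circle.IsBoundedLipschitz M F) (y : AddCircle (1 : ℝ)) : ‖toCircleFun F y‖ ≤ 1 := by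
  unfold toCircleFun
  rw [Complex.norm_real, Real.norm_eq_abs]
  exact hF.1 _

/-- `toCircleFun F` as a continuous map (Lipschitz functions are continuous). [folklore] -/
def toCircleMap {M : ℝ} {F : Nilmanifold.circle.G ⧸ Nilmanifold.circle.Γ → ℝ}
    (hF : Nilmanifold.circle.IsBoundedLipschitz M F) : C(AddCircle (1 : ℝ), ℂ) where
  toFun := toCircleFun F
  continuous_toFun := by
    have hL : LipschitzWith (Real.toNNReal (max M 0)) (toCircleFun F) :=
      LipschitzWith.of_dist_le_mul fun y z => by
        rw [dist_eq_norm, Real.coe_toNNReal _ (le_max_right _ _)]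
        exact toCircleFun_lipschitz hF y z
    exact hL.continuous

/-- `fourier m (r + ℤ) = e(m r)`. [folklore] -/
theorem fourier_coe_eq_eChar (m : ℤ) (r : ℝ) : fourier m ((r : ℝ) : AddCircle (1 : ℝ)) = eChar (m * r) := by
  rw [fourier_coe_apply]
  unfold eChar
  congr 1
  push_cast
  ring

/-- The accuracy parameter `K = ⌈16 M²/δ²⌉ + 1`: `M/√K ≤ δ/4`. [folklore] -/
theorem div_sqrt_le_of_K {M δ : ℝ} (hM : 0 ≤ M) (hδ : 0 < δ) :
    M / Real.sqrt ((⌈16 * M ^ 2 / δ ^ 2⌉₊ + 1 : ℕ) : ℝ) ≤ δ / 4 := by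
  set K : ℕ := ⌈16 * M ^ 2 / δ ^ 2⌉₊ + 1 with hK
  have hKge : 16 * M ^ 2 / δ ^ 2 ≤ (K : ℝ) := by
    rw [hK]; push_cast; linarith [Nat.le_ceil (16 * M ^ 2 / δ ^ 2)]
  have hKpos : (0 : ℝ) < K := by rw [hK]; positivity
  have hsqrt : 0 < Real.sqrt K := Real.sqrt_pos.mpr hKpos
  rw [div_le_iff₀ hsqrt]
  have h1 : 4 * M / δ ≤ Real.sqrt K := by
    rw [Real.le_sqrt (by positivity) hKpos.le]
    calc (4 * M / δ) ^ 2 = 16 * M ^ 2 / δ ^ 2 := by rw [div_pow]; ring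
      _ ≤ (K : ℝ) := hKge
  rw [div_le_iff₀ hδ] at h1
  nlinarith

open Literature.Analysis.Fourier in
/-- **Correlations with a rotation nilsequence decompose into exponential sums** (the Fourier
expansion step common to Cor. 11.6 and Prop. 10.2 at `s = 1`): for a `1`-bounded `M`-Lipschitz
`F : ℝ/ℤ → ℝ`, `K ≥ 1`, `N ≥ 1`, a real weight `a` and the rotation `g = α`, `x = x₀ + ℤ`,
`|𝔼_{n ∈ [N]} a(n) F(x₀ + nα)| ≤ (max(M,0)/√K) 𝔼_{n∈[N]} |a(n)| + (1/N) ∑_{|m| < K} |∑_{n ∈ [N]} a(n) e(n mα)|`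
(approximate `F` by its Fourier partial sum of order `K`, Bernstein's theorem). [cite: GreenTao2010,
§11 (first paragraph, the case `s = 1`) and Cor. 11.6] [cite: Katznelson2004, Ch. I, §6.3] -/
theorem abs_orbitAverage_circle_le {M : ℝ} {F : Nilmanifold.circle.G ⧸ Nilmanifold.circle.Γ → ℝ}
    (hF : Nilmanifold.circle.IsBoundedLipschitz M F) {K : ℕ} (hK : 1 ≤ K) {N : ℕ} (hN : 1 ≤ N)
    (a : ℕ → ℝ) (α x₀ : ℝ) :
    |Nilmanifold.circle.orbitAverage N a F (Multiplicative.ofAdd α) (circlePt x₀)| ≤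
      max M 0 / Real.sqrt K * ((∑ n ∈ Finset.Icc 1 N, |a n|) / N) +
        (∑ m ∈ Finset.Ioo (-(K : ℤ)) K,
          ‖∑ n ∈ Finset.Icc 1 N, (a n : ℂ) * eChar (n * (m * α))‖) / N := by
  have hNpos : (0 : ℝ) < N := by exact_mod_cast hN
  set M₀ : ℝ := max M 0 with hM₀
  have hM₀ : 0 ≤ M₀ := le_max_right _ _
  set g : Nilmanifold.circle.G := Multiplicative.ofAdd α with hg
  -- the orbit average as a sum over `[N]`
  have hnil : ∀ n : ℕ, Nilmanifold.circle.nilsequence F (Multiplicative.ofAdd α) (circlePt x₀) n =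
      F (circlePt (x₀ + n * α)) := fun n => Nilmanifold.nilsequence_circle F α x₀ n
  have horbit : Nilmanifold.circle.orbitAverage N a F g (circlePt x₀) =
      (∑ n ∈ Finset.Icc 1 N, a n * F (circlePt (x₀ + n * α))) / N := by
    rw [Nilmanifold.orbitAverage_eq_sum_nilsequence, hg]
    congr 1
    exact Finset.sum_congr rfl fun n _ => congrArg (fun t => a n * t) (hnil n)
  -- the continuous map on `AddCircle 1` and its Fourier approximation
  set Fc : C(AddCircle (1 : ℝ), ℂ) := toCircleMap hF with hFc
  have hFc_apply : ∀ r : ℝ, Fc ((r : ℝ) : AddCircle (1 : ℝ)) = ((F (circlePt r) : ℝ) : ℂ) := fun r => rfl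
  have hLip : ∀ y z, ‖Fc y - Fc z‖ ≤ M₀ * dist y z := toCircleFun_lipschitz hF
  have hbd : ∀ y, ‖Fc y‖ ≤ 1 := norm_toCircleFun_le hF
  have happrox : ∀ y, ‖Fc y - ∑ m ∈ Finset.Ioo (-(K : ℤ)) K, fourierCoeff Fc m * fourier m y‖ ≤
      M₀ / Real.sqrt K := fun y => norm_sub_trigPoly_le Fc hM₀ hLip hK y
  have hcoef1 : ∀ m, ‖fourierCoeff Fc m‖ ≤ 1 := norm_fourierCoeff_le_one Fc hbd
  -- `A = 𝔼 a(n) F(x₀ + nα)` as a complex number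
  set A : ℂ := (∑ n ∈ Finset.Icc 1 N, (a n : ℂ) * Fc (((x₀ + n * α : ℝ)) : AddCircle (1 : ℝ))) / N
    with hAdef
  have hA : ((Nilmanifold.circle.orbitAverage N a F g (circlePt x₀) : ℝ) : ℂ) = A := by
    rw [horbit, hAdef, Complex.ofReal_div, Complex.ofReal_natCast, Complex.ofReal_sum]
    congr 1
    refine Finset.sum_congr rfl fun n _ => ?_
    rw [Complex.ofReal_mul, hFc_apply]
  -- the exponential sums `S_m = ∑ a(n) e(n mα)` and the main term `B`
  set Sm : ℤ → ℂ := fun m => ∑ n ∈ Finset.Icc 1 N, (a n : ℂ) * eChar (n * (m * α)) with hSm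
  set B : ℂ := (∑ m ∈ Finset.Ioo (-(K : ℤ)) K, fourierCoeff Fc m * eChar (m * x₀) * Sm m) / N with hBdef
  have hAB : ‖A - B‖ ≤ M₀ / Real.sqrt K * ((∑ n ∈ Finset.Icc 1 N, |a n|) / N) := by
    have hBalt : B = (∑ n ∈ Finset.Icc 1 N, (a n : ℂ) *
        ∑ m ∈ Finset.Ioo (-(K : ℤ)) K, fourierCoeff Fc m * fourier m (((x₀ + n * α : ℝ)) : AddCircle (1 : ℝ))) / N := by
      rw [hBdef]
      congr 1
      rw [hSm]
      simp_rw [Finset.mul_sum]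
      rw [Finset.sum_comm]
      refine Finset.sum_congr rfl fun n _ => Finset.sum_congr rfl fun m _ => ?_
      rw [fourier_coe_eq_eChar, show (m : ℝ) * (x₀ + n * α) = m * x₀ + n * (m * α) by ring, eChar_add]
      ring
    rw [hBalt, hAdef, ← sub_div, ← Finset.sum_sub_distrib, norm_div, Complex.norm_natCast,
      mul_div_assoc', div_le_div_iff_of_pos_right hNpos]
    refine (norm_sum_le _ _).trans ?_
    have hterm : ∀ n ∈ Finset.Icc 1 N,
        ‖(a n : ℂ) * Fc (((x₀ + n * α : ℝ)) : AddCircle (1 : ℝ)) - (a n : ℂ) *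
            ∑ m ∈ Finset.Ioo (-(K : ℤ)) K, fourierCoeff Fc m * fourier m (((x₀ + n * α : ℝ)) : AddCircle (1 : ℝ))‖ ≤
          |a n| * (M₀ / Real.sqrt K) := by
      intro n _
      rw [← mul_sub, norm_mul, Complex.norm_real, Real.norm_eq_abs]
      exact mul_le_mul_of_nonneg_left (happrox _) (abs_nonneg _)
    refine (Finset.sum_le_sum hterm).trans (le_of_eq ?_)
    rw [← Finset.sum_mul, mul_comm]
  have hBle : ‖B‖ ≤ (∑ m ∈ Finset.Ioo (-(K : ℤ)) K, ‖Sm m‖) / N := by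
    rw [hBdef, norm_div, Complex.norm_natCast]
    refine div_le_div_of_nonneg_right ((norm_sum_le _ _).trans (Finset.sum_le_sum fun m _ => ?_)) hNpos.le
    rw [norm_mul, norm_mul, norm_eChar, mul_one]
    exact mul_le_of_le_one_left (norm_nonneg _) (hcoef1 m)
  have hfin : ‖A‖ ≤ ‖A - B‖ + ‖B‖ := by
    calc ‖A‖ = ‖(A - B) + B‖ := by rw [sub_add_cancel]
      _ ≤ ‖A - B‖ + ‖B‖ := norm_add_le _ _
  have hnormA : |Nilmanifold.circle.orbitAverage N a F g (circlePt x₀)| = ‖A‖ := by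
    rw [← hA, Complex.norm_real, Real.norm_eq_abs]
  rw [hnormA]
  exact hfin.trans (add_le_add hAB hBle)

open Literature.Analysis.Fourier in
/-- **Cor. 11.6 of Green–Tao 2010 for the circle `ℝ/ℤ` (nilsequences obstruct uniformity, II, at
`s = 1` for the rotation nilsequences `F(x₀ + nα)`), PROVED.** For every Lipschitz bound `M` and
`δ ∈ (0,1)` there is `c = c(δ, M) > 0` such that, for `N ≥ 1`, a `1`-bounded `M`-Lipschitz
`F : ℝ/ℤ → ℝ`, `α, x₀ ∈ ℝ`, and `f : [N] → ℝ` with `𝔼_{n ∈ [N]} |f(n)| ≤ 1` and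
`|𝔼_{n ∈ [N]} f(n) F(x₀ + nα)| ≥ δ`, we have `‖f‖_{U²[N]} ≥ c`. Proof: approximate `F` uniformly
within `δ/4` by its Fourier partial sum of order `K = O(M²/δ²)` (Bernstein's theorem,
`Literature.Analysis.Fourier.norm_sub_trigPoly_le`), so that some character correlates:
`|𝔼 f(n) e(mαn)| ≥ 3δ/(4(2K-1))`; then `uniformityNorm_ge_of_expSum`.
[cite: GreenTao2010, Cor. 11.6 (the case `s = 1`, `G/Γ = ℝ/ℤ`) and §11 (first paragraph: the
`s = 1` case "amounts to a certain `ℓ^{4/3}` summability estimate on the Fourier coefficients")]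
[cite: Katznelson2004, Ch. I, §6.3 (Bernstein's theorem)] -/
theorem GreenTao2010_nilObstructionAt_one_circle (M : ℝ) :
    GreenTao2010_nilObstructionAt 1 Nilmanifold.circle M := by
  intro δ hδ _hδ1
  set M₀ : ℝ := max M 0 with hM₀
  have hM₀ : 0 ≤ M₀ := le_max_right _ _
  set K : ℕ := ⌈16 * M₀ ^ 2 / δ ^ 2⌉₊ + 1 with hK
  have hK1 : 1 ≤ K := by omega
  have hcardK : ((Finset.Ioo (-(K : ℤ)) K).card : ℝ) = 2 * K - 1 := by
    rw [Int.card_Ioo]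
    have : ((K : ℤ) - -(K : ℤ) - 1).toNat = 2 * K - 1 := by omega
    rw [this]
    push_cast [show 1 ≤ 2 * K by omega]
    ring
  have hcardpos : (0 : ℝ) < 2 * K - 1 := by
    have : (1 : ℝ) ≤ K := by exact_mod_cast hK1
    linarith
  set η : ℝ := 3 * δ / 4 / (2 * K - 1) with hη
  have hηpos : 0 < η := by rw [hη]; positivity
  refine ⟨η / (2 * expSumMod η), by
    have := two_le_expSumMod η
    have : (0 : ℝ) < expSumMod η := by exact_mod_cast (show 0 < expSumMod η by omega)
    positivity, ?_⟩
  intro N hN g x F hF f hfL1 hcorr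
  have hNpos : (0 : ℝ) < N := by exact_mod_cast hN
  obtain ⟨x₀, rfl⟩ := exists_eq_circlePt x
  set α : ℝ := Multiplicative.toAdd (show Multiplicative ℝ from g) with hα
  have hg : g = Multiplicative.ofAdd α := rfl
  -- the `L¹` bound in the form `∑ |f| ≤ N`
  have hf1 : ∑ n ∈ Finset.Icc 1 N, |f (n : ℕ)| ≤ N := by
    have h := hfL1
    rw [div_le_one hNpos, sum_Icc_int_eq_sum_Icc_nat] at h
    exact h
  -- the decomposition into exponential sums
  have hdec : |Nilmanifold.circle.orbitAverage N (fun n => f n) F g (circlePt x₀)| ≤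
      M₀ / Real.sqrt K * ((∑ n ∈ Finset.Icc 1 N, |f (n : ℕ)|) / N) +
        (∑ m ∈ Finset.Ioo (-(K : ℤ)) K,
          ‖∑ n ∈ Finset.Icc 1 N, ((f (n : ℕ) : ℝ) : ℂ) * eChar (n * (m * α))‖) / N :=
    abs_orbitAverage_circle_le hF hK1 hN (fun n => f n) α x₀
  set Sm : ℤ → ℂ := fun m => ∑ n ∈ Finset.Icc 1 N, ((f (n : ℕ) : ℝ) : ℂ) * eChar (n * (m * α)) with hSm
  have herr : M₀ / Real.sqrt K * ((∑ n ∈ Finset.Icc 1 N, |f (n : ℕ)|) / N) ≤ δ / 4 := by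
    have h1 : M₀ / Real.sqrt K ≤ δ / 4 := by rw [hK]; exact div_sqrt_le_of_K hM₀ hδ
    have h2 : (∑ n ∈ Finset.Icc 1 N, |f (n : ℕ)|) / N ≤ 1 := by rwa [div_le_one hNpos]
    calc M₀ / Real.sqrt K * ((∑ n ∈ Finset.Icc 1 N, |f (n : ℕ)|) / N) ≤ δ / 4 * 1 :=
          mul_le_mul h1 h2 (by positivity) (by positivity)
      _ = δ / 4 := mul_one _
  have hmain : 3 * δ / 4 ≤ (∑ m ∈ Finset.Ioo (-(K : ℤ)) K, ‖Sm m‖) / N := by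
    have := hcorr.trans hdec
    rw [hSm]
    linarith
  -- some character correlates
  obtain ⟨m, -, hSmge⟩ : ∃ m ∈ Finset.Ioo (-(K : ℤ)) K, η * N ≤ ‖Sm m‖ := by
    by_contra hall
    push Not at hall
    have hne : (Finset.Ioo (-(K : ℤ)) K).Nonempty := ⟨0, Finset.mem_Ioo.mpr ⟨by omega, by omega⟩⟩
    have hlt : ∑ m ∈ Finset.Ioo (-(K : ℤ)) K, ‖Sm m‖ < ∑ _m ∈ Finset.Ioo (-(K : ℤ)) K, η * N :=
      Finset.sum_lt_sum_of_nonempty hne fun m hm => hall m hm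
    rw [Finset.sum_const, nsmul_eq_mul, hcardK] at hlt
    have h3 : (2 * K - 1) * (η * N) = 3 * δ / 4 * N := by rw [hη]; field_simp
    rw [h3] at hlt
    rw [le_div_iff₀ hNpos] at hmain
    linarith
  -- conclude by the exponential sum lemma
  exact uniformityNorm_ge_of_expSum hN f hf1 hηpos (m * α) (by rw [hSm] at hSmge; exact hSmge)

open Literature.Analysis.Fourier in
/-- **Prop. 10.2 of Green–Tao 2010 for the circle, from uniform exponential-sum estimates for the
`W`-tricked primes** (the case `s = 1` of "`MN(s)` implies Prop. 10.2", §12, reduced to its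
classical core): if `sup_α |∑_{n ≤ N} (Λ'_{b,W}(n) - 1) e(nα)| = o(N)` uniformly in the residue
`b` and the admissible cutoff `w` (the Hardy–Littlewood–Vinogradov estimate: Siegel–Walfisz on the
major arcs, Vinogradov's bound on the minor arcs), then
`𝔼_{n ∈ [N]} (Λ'_{b,W}(n) - 1) F(x₀ + nα) = o_M(1)` for every `1`-bounded `M`-Lipschitz `F : ℝ/ℤ → ℝ`
(`GreenTao2010_nilsequenceOrthogonalityAt 1 circle M`). Proof: `abs_orbitAverage_circle_le` with
`K = O(M²/ε²)`; the `L¹` bound `𝔼 |Λ'_{b,W} - 1| ≤ 3` is the case `α = 0` of the hypothesis.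
[cite: GreenTao2010, Prop. 10.2 and §12 (the case `s = 1`), Conj. 8.5 `MN(1)` (Davenport)] -/
theorem GreenTao2010_nilsequenceOrthogonalityAt_one_circle_of_expSum
    (hexp : ∀ ε : ℝ, 0 < ε → ∃ w₀ N₀ : ℕ, ∀ N : ℕ, N₀ ≤ N →
      ∀ w : ℕ, w₀ ≤ w → (w : ℝ) ≤ Real.log (Real.log N) / 2 →
        ∀ b : ℕ, 1 ≤ b → b ≤ primorial w → Nat.Coprime b (primorial w) →
          ∀ α : ℝ, ‖∑ n ∈ Finset.Icc 1 N,
            ((vonMangoldtW (primorial w) b n - 1 : ℝ) : ℂ) * eChar (n * α)‖ ≤ ε * N)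
    (M : ℝ) : GreenTao2010_nilsequenceOrthogonalityAt 1 Nilmanifold.circle M := by
  intro ε hε
  set M₀ : ℝ := max M 0 with hM₀
  have hM₀ : 0 ≤ M₀ := le_max_right _ _
  -- `K` with `M₀/√K ≤ ε/8`
  set K : ℕ := ⌈16 * M₀ ^ 2 / (ε / 2) ^ 2⌉₊ + 1 with hK
  have hK1 : 1 ≤ K := by omega
  have hKerr : M₀ / Real.sqrt K ≤ ε / 8 := by
    have := div_sqrt_le_of_K hM₀ (half_pos hε)
    rw [← hK] at this
    linarith
  have hcardK : ((Finset.Ioo (-(K : ℤ)) K).card : ℝ) = 2 * K - 1 := by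
    rw [Int.card_Ioo]
    have : ((K : ℤ) - -(K : ℤ) - 1).toNat = 2 * K - 1 := by omega
    rw [this]
    push_cast [show 1 ≤ 2 * K by omega]
    ring
  have hcardpos : (0 : ℝ) < 2 * K - 1 := by
    have : (1 : ℝ) ≤ K := by exact_mod_cast hK1
    linarith
  -- the exponential sums at precision `ε₂ = min(1, ε/(2(2K-1)))`
  set ε₂ : ℝ := min 1 (ε / 2 / (2 * K - 1)) with hε₂
  have hε₂pos : 0 < ε₂ := lt_min one_pos (by positivity)
  obtain ⟨w₀, N₀, H⟩ := hexp ε₂ hε₂pos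
  refine ⟨w₀, N₀ + 1, ?_⟩
  intro N hN w hw hwN b hb1 hbW hbcop g x F hF
  have hN1 : 1 ≤ N := by omega
  have hNpos : (0 : ℝ) < N := by exact_mod_cast hN1
  obtain ⟨x₀, rfl⟩ := exists_eq_circlePt x
  set α : ℝ := Multiplicative.toAdd (show Multiplicative ℝ from g) with hα
  have hg : g = Multiplicative.ofAdd α := rfl
  have HN := H N (by omega) w hw hwN b hb1 hbW hbcop
  set a : ℕ → ℝ := fun n => vonMangoldtW (primorial w) b n - 1 with ha
  -- the `L¹` bound from `α = 0`
  have hL1 : (∑ n ∈ Finset.Icc 1 N, |a n|) / N ≤ 3 := by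
    have h0 := HN 0
    simp only [mul_zero] at h0
    have he0 : eChar 0 = 1 := by unfold eChar; simp
    simp_rw [he0, mul_one] at h0
    rw [← Complex.ofReal_sum, Complex.norm_real, Real.norm_eq_abs] at h0
    have hsum : ∑ n ∈ Finset.Icc 1 N, |a n| ≤ ∑ n ∈ Finset.Icc 1 N, (a n + 2) := by
      refine Finset.sum_le_sum fun n _ => ?_
      rw [ha]; dsimp only
      have := (vonMangoldtW_nonneg_le_log (primorial w) b n).1
      rw [abs_le]; constructor <;> linarith
    rw [Finset.sum_add_distrib, Finset.sum_const, Nat.card_Icc, nsmul_eq_mul] at hsum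
    have h1 : ∑ n ∈ Finset.Icc 1 N, a n ≤ ε₂ * N := (le_abs_self _).trans h0
    have h2 : ε₂ ≤ 1 := min_le_left _ _
    rw [div_le_iff₀ hNpos]
    have : ((N + 1 - 1 : ℕ) : ℝ) = N := by push_cast; ring
    rw [this] at hsum
    nlinarith
  -- the decomposition
  have hdec : |Nilmanifold.circle.orbitAverage N a F g (circlePt x₀)| ≤
      M₀ / Real.sqrt K * ((∑ n ∈ Finset.Icc 1 N, |a n|) / N) +
        (∑ m ∈ Finset.Ioo (-(K : ℤ)) K,
          ‖∑ n ∈ Finset.Icc 1 N, (a n : ℂ) * eChar (n * (m * α))‖) / N :=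
    abs_orbitAverage_circle_le hF hK1 hN1 a α x₀
  have hterm1 : M₀ / Real.sqrt K * ((∑ n ∈ Finset.Icc 1 N, |a n|) / N) ≤ ε / 8 * 3 :=
    mul_le_mul hKerr hL1 (by positivity) (by positivity)
  have hterm2 : (∑ m ∈ Finset.Ioo (-(K : ℤ)) K,
      ‖∑ n ∈ Finset.Icc 1 N, (a n : ℂ) * eChar (n * (m * α))‖) / N ≤ ε / 2 := by
    rw [div_le_iff₀ hNpos]
    calc ∑ m ∈ Finset.Ioo (-(K : ℤ)) K, ‖∑ n ∈ Finset.Icc 1 N, (a n : ℂ) * eChar (n * (m * α))‖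
        ≤ ∑ _m ∈ Finset.Ioo (-(K : ℤ)) K, ε₂ * N := Finset.sum_le_sum fun m _ => by
          have := HN (m * α)
          rw [ha]; exact this
      _ = (2 * K - 1) * (ε₂ * N) := by rw [Finset.sum_const, nsmul_eq_mul, hcardK]
      _ ≤ (2 * K - 1) * (ε / 2 / (2 * K - 1) * N) := by
          have : ε₂ ≤ ε / 2 / (2 * K - 1) := min_le_right _ _
          gcongr
      _ = ε / 2 * N := by field_simp
  have : |Nilmanifold.circle.orbitAverage N (fun n => vonMangoldtW (primorial w) b n - 1) F g (circlePt x₀)| ≤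
      ε / 8 * 3 + ε / 2 := (hdec.trans (add_le_add hterm1 hterm2))
  linarith

end circleobs

end Literature.NumberTheory.Sieve

namespace Literature.NumberTheory.Sieve

/-- **Thm. 7.2 of Green–Tao 2010 at level `s = 1` from the uniform exponential-sum estimate for
the `W`-tricked primes.** If `sup_α |∑_{n ≤ N} (Λ'_{b,W}(n) - 1) e(nα)| ≤ εN` for `N ≥ N₀(ε)`,
uniformly in the admissible `w` and the residue `b` coprime to `W`, then
`‖Λ'_{b,W} - 1‖_{U²[N]} = o(1)` in the same uniformity (`GreenTao2010_gowersUniformityAt 1`). All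
other ingredients — Prop. 6.4 (App. D), the §10 assembly, Prop. 10.1 with Prop. 10.3, `GI(1)`,
Cor. 11.6 and the Fourier reduction of Prop. 10.2 on the circle — are proved in the tree.
[cite: GreenTao2010, Thm. 7.2 (the case `s = 1`), §10, Conj. 8.5 `MN(1)`, Prop. 10.2] -/
theorem GreenTao2010_gowersUniformityAt_one_of_expSum
    (hexp : ∀ ε : ℝ, 0 < ε → ∃ w₀ N₀ : ℕ, ∀ N : ℕ, N₀ ≤ N →
      ∀ w : ℕ, w₀ ≤ w → (w : ℝ) ≤ Real.log (Real.log N) / 2 →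
        ∀ b : ℕ, 1 ≤ b → b ≤ primorial w → Nat.Coprime b (primorial w) →
          ∀ α : ℝ, ‖∑ n ∈ Finset.Icc 1 N,
            ((vonMangoldtW (primorial w) b n - 1 : ℝ) : ℂ) * eChar (n * α)‖ ≤ ε * N) :
    GreenTao2010_gowersUniformityAt 1 :=
  GreenTao2010_gowersUniformityAt_one_of_circle (GreenTao2010_nilObstructionAt_one_circle _)
    (GreenTao2010_nilsequenceOrthogonalityAt_one_circle_of_expSum hexp _)

end Literature.NumberTheory.Sieve
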